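import Mathlib.Analysis.SpecialFunctions.Trigonometric.DerivHyp
import Mathlib.Analysis.SpecialFunctions.Trigonometric.Series
import Mathlib.Analysis.Convex.SpecificFunctions.Basic
import Mathlib.Algebra.BigOperators.Field
import Mathlib.Analysis.SpecialFunctions.Log.Basic
import Mathlib.Data.Nat.ChineseRemainder
import Mathlib.Algebra.Order.BigOperators.Ring.Finset
import HarnessLib

/-!
# A finite Hoeffding inequality for sums of functions of independent residues (Tao 2016, Lemma 3.5)

Topic `Literature/NumberTheory/LFunctions`. Everything in this file is PROVED (no named facts).

Tao's proof of Theorem 2.3 (Forum Math. Pi 4 (2016) e8, §3) needs Hoeffding's inequality for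
`F(x, y) = ∑_{p ∈ 𝒫_H} F_p(x, y mod p)`, `y` uniform on `ℤ/P_Hℤ`, `P_H = ∏ p`: "the `y mod p` are
uniformly distributed in `ℤ/pℤ` and are jointly independent in `p`" (Chinese remainder theorem).
We prove the needed inequality in a self-contained finite form, by the exponential-moment method,
avoiding measure-theoretic independence:

* `sum_range_mul_mod` — CRT as a bijection `[0, mn) → [0,m) × [0,n)` in summatory form;
  `sum_range_prod_mod` — `∑_{y<P} ∏_{p∈S} g_p(y mod p) = ∏_{p∈S} ∑_{r<p} g_p(r)` for a finite set
  `S` of primes.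
* `exp_mul_le_cosh_add` (convexity), `sum_exp_mul_le` (one factor: `≤ p exp(λ²D²/2)` via
  `cosh x ≤ exp(x²/2)`), `sum_exp_mul_sum_le` (the exponential moment),
  `card_filter_le_mul_exp_le` (Markov), `card_filter_le_sum_le` (one-sided tail), and
* `card_filter_le_abs_sum_sub_le` — **`#{y < P : |Z(y) - μ| ≥ t} ≤ 2 P exp(-t²/(8 C² #S))`** for
  `Z(y) = ∑_{p∈S} f_p(y mod p)`, `|f_p| ≤ C`, `μ` the mean of `Z` (Hoeffding with the constant `8`
  in place of the optimal `2`, immaterial for the application).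

## References
* T. Tao, Forum Math. Pi 4 (2016) e8; arXiv:1509.05422, §3 Lemma 3.5.
* W. Hoeffding, *Probability inequalities for sums of bounded random variables*, J. Amer. Statist.
  Assoc. 58 (1963) 13–30, Thm 2 (the inequality being specialised).
-/

open Finset Real

noncomputable section

namespace Literature.NumberTheory.LFunctions

namespace Tao2016

/-! ### Sums over residues modulo a product of coprime moduli -/

/-- **CRT as a bijection of finite sets**: for coprime `m, n ≥ 1`,
`y ↦ (y mod m, y mod n)` maps `[0, mn)` bijectively onto `[0,m) × [0,n)`; in summatory form
`∑_{y < mn} F(y mod m, y mod n) = ∑_{u < m} ∑_{v < n} F(u, v)`. [folklore] -/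
theorem sum_range_mul_mod (m n : ℕ) (hm : 0 < m) (hn : 0 < n) (hmn : Nat.Coprime m n)
    (F : ℕ → ℕ → ℝ) :
    ∑ y ∈ range (m * n), F (y % m) (y % n) = ∑ u ∈ range m, ∑ v ∈ range n, F u v := by
  set φ : ℕ → ℕ × ℕ := fun y => (y % m, y % n) with hφ
  have hinj : Set.InjOn φ (range (m * n) : Set ℕ) := by
    intro y hy y' hy' h
    simp only [coe_range, Set.mem_Iio] at hy hy'
    simp only [hφ, Prod.mk.injEq] at h
    have h1 : y ≡ y' [MOD m] := h.1
    have h2 : y ≡ y' [MOD n] := h.2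
    have h3 : y ≡ y' [MOD m * n] := (Nat.modEq_and_modEq_iff_modEq_mul hmn).1 ⟨h1, h2⟩
    have := Nat.ModEq.eq_of_lt_of_lt h3 hy hy'
    exact this
  have himg : (range (m * n)).image φ = range m ×ˢ range n := by
    apply eq_of_subset_of_card_le
    · intro q hq
      obtain ⟨y, _, rfl⟩ := mem_image.1 hq
      simp only [hφ, mem_product, mem_range]
      exact ⟨Nat.mod_lt _ hm, Nat.mod_lt _ hn⟩
    · rw [card_product, card_range, card_range, card_image_of_injOn hinj, card_range]
  rw [← sum_product' (f := fun u v => F u v), ← himg, sum_image hinj]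

/-- **Sums of products over residues factor** (CRT): for a finite set `S` of primes,
`P = ∏_{p ∈ S} p`, and functions `g_p`,
`∑_{y < P} ∏_{p ∈ S} g_p(y mod p) = ∏_{p ∈ S} ∑_{r < p} g_p(r)`. [folklore] -/
theorem sum_range_prod_mod (S : Finset ℕ) (hS : ∀ p ∈ S, p.Prime) (g : ℕ → ℕ → ℝ) :
    ∑ y ∈ range (∏ p ∈ S, p), ∏ p ∈ S, g p (y % p) = ∏ p ∈ S, ∑ r ∈ range p, g p r := by
  induction S using Finset.induction_on with
  | empty => simp
  | insert q S hq ih =>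
    have hqP : (q : ℕ).Prime := hS q (mem_insert_self q S)
    have hS' : ∀ p ∈ S, p.Prime := fun p hp => hS p (mem_insert_of_mem hp)
    simp only [prod_insert hq]
    have hcop : Nat.Coprime q (∏ p ∈ S, p) := by
      refine Nat.Coprime.prod_right fun p hp => ?_
      exact (Nat.coprime_primes hqP (hS' p hp)).2 (fun h => hq (h ▸ hp))
    have hPpos : 0 < ∏ p ∈ S, p := prod_pos fun p hp => (hS' p hp).pos
    have key := sum_range_mul_mod q (∏ p ∈ S, p) hqP.pos hPpos hcop
      (fun u v => g q u * ∏ p ∈ S, g p (v % p))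
    have e1 : ∀ y : ℕ, ∏ p ∈ S, g p (y % p) = ∏ p ∈ S, g p ((y % ∏ p' ∈ S, p') % p) := by
      intro y
      refine prod_congr rfl fun p hp => ?_
      rw [Nat.mod_mod_of_dvd _ (dvd_prod_of_mem _ hp)]
    calc ∑ y ∈ range (q * ∏ p ∈ S, p), g q (y % q) * ∏ p ∈ S, g p (y % p)
        = ∑ y ∈ range (q * ∏ p ∈ S, p), g q (y % q) * ∏ p ∈ S, g p ((y % ∏ p' ∈ S, p') % p) := by
          refine sum_congr rfl fun y _ => ?_; rw [e1]
      _ = ∑ u ∈ range q, ∑ v ∈ range (∏ p ∈ S, p), g q u * ∏ p ∈ S, g p (v % p) := key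
      _ = (∑ r ∈ range q, g q r) * ∏ p ∈ S, ∑ r ∈ range p, g p r := by
          rw [← ih hS', sum_mul]
          refine sum_congr rfl fun u _ => ?_
          rw [mul_sum]

/-! ### The exponential moment -/

/-- Convexity bound behind Hoeffding's lemma: for `|u| ≤ D`, `D > 0`,
`exp(λ u) ≤ cosh(λ D) + (u/D) sinh(λ D)`. [folklore] -/
theorem exp_mul_le_cosh_add {u D : ℝ} (hD : 0 < D) (hu : |u| ≤ D) (l : ℝ) :
    Real.exp (l * u) ≤ Real.cosh (l * D) + u / D * Real.sinh (l * D) := by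
  have hu' := abs_le.1 hu
  set θ : ℝ := (1 + u / D) / 2 with hθ
  have hθ0 : 0 ≤ θ := by
    rw [hθ]; apply div_nonneg _ (by norm_num)
    have : -1 ≤ u / D := by rw [le_div_iff₀ hD]; linarith
    linarith
  have hθ1 : 0 ≤ 1 - θ := by
    rw [hθ]
    have : u / D ≤ 1 := by rw [div_le_one hD]; linarith
    linarith
  have hconv := convexOn_exp.2 (Set.mem_univ (l * D)) (Set.mem_univ (-(l * D))) hθ0 hθ1
    (by ring)
  simp only [smul_eq_mul] at hconv
  have e1 : θ * (l * D) + (1 - θ) * (-(l * D)) = l * u := by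
    rw [hθ]; field_simp; ring
  rw [e1] at hconv
  refine hconv.trans (le_of_eq ?_)
  rw [Real.cosh_eq, Real.sinh_eq, hθ]
  field_simp
  ring

/-- One factor of the exponential moment: if `|g(r)| ≤ D` on `[0,p)` and `∑_{r<p} g(r) = 0`, then
`∑_{r<p} exp(λ g(r)) ≤ p exp(λ² D²/2)`. [folklore] -/
theorem sum_exp_mul_le {p : ℕ} {g : ℕ → ℝ} {D : ℝ} (hD : 0 < D) (hg : ∀ r ∈ range p, |g r| ≤ D)
    (h0 : ∑ r ∈ range p, g r = 0) (l : ℝ) :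
    ∑ r ∈ range p, Real.exp (l * g r) ≤ p * Real.exp (l ^ 2 * D ^ 2 / 2) := by
  calc ∑ r ∈ range p, Real.exp (l * g r)
      ≤ ∑ r ∈ range p, (Real.cosh (l * D) + g r / D * Real.sinh (l * D)) :=
        sum_le_sum fun r hr => exp_mul_le_cosh_add hD (hg r hr) l
    _ = p * Real.cosh (l * D) := by
        rw [sum_add_distrib, sum_const, card_range, nsmul_eq_mul, ← sum_mul, ← Finset.sum_div, h0]
        simp
    _ ≤ p * Real.exp (l ^ 2 * D ^ 2 / 2) := by
        refine mul_le_mul_of_nonneg_left ?_ (Nat.cast_nonneg p)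
        have := Real.cosh_le_exp_half_sq (l * D)
        rwa [show (l * D) ^ 2 / 2 = l ^ 2 * D ^ 2 / 2 by ring] at this

/-- **Exponential moment of a sum of functions of independent residues.** For a finite set `S`
of primes, `P = ∏ p`, functions `g_p` with `|g_p| ≤ D` on `[0,p)` and `∑_{r<p} g_p(r) = 0`:
`∑_{y<P} exp(λ ∑_{p∈S} g_p(y mod p)) ≤ P exp(λ² D² #S / 2)`. [folklore] -/
theorem sum_exp_mul_sum_le (S : Finset ℕ) (hS : ∀ p ∈ S, p.Prime) {g : ℕ → ℕ → ℝ} {D : ℝ}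
    (hD : 0 < D) (hg : ∀ p ∈ S, ∀ r ∈ range p, |g p r| ≤ D)
    (h0 : ∀ p ∈ S, ∑ r ∈ range p, g p r = 0) (l : ℝ) :
    ∑ y ∈ range (∏ p ∈ S, p), Real.exp (l * ∑ p ∈ S, g p (y % p)) ≤
      (∏ p ∈ S, p : ℕ) * Real.exp (l ^ 2 * D ^ 2 * #S / 2) := by
  have e1 : ∀ y, Real.exp (l * ∑ p ∈ S, g p (y % p)) = ∏ p ∈ S, Real.exp (l * g p (y % p)) := by
    intro y
    rw [mul_sum, Real.exp_sum]
  simp_rw [e1]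
  rw [sum_range_prod_mod S hS (fun p r => Real.exp (l * g p r))]
  calc ∏ p ∈ S, ∑ r ∈ range p, Real.exp (l * g p r)
      ≤ ∏ p ∈ S, ((p : ℝ) * Real.exp (l ^ 2 * D ^ 2 / 2)) := by
        refine prod_le_prod (fun p _ => sum_nonneg fun r _ => (Real.exp_pos _).le) ?_
        intro p hp
        exact sum_exp_mul_le hD (hg p hp) (h0 p hp) l
    _ = (∏ p ∈ S, p : ℕ) * Real.exp (l ^ 2 * D ^ 2 * #S / 2) := by
        rw [prod_mul_distrib, prod_const, ← Real.exp_nat_mul]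
        push_cast
        congr 1
        congr 1
        ring

/-! ### The tail bound -/

/-- **Markov's inequality for the exponential moment** (finite form): for `λ ≥ 0`,
`#{y ∈ T : t ≤ Z(y)} · exp(λ t) ≤ ∑_{y ∈ T} exp(λ Z(y))`. [folklore] -/
theorem card_filter_le_mul_exp_le {T : Finset ℕ} (Z : ℕ → ℝ) (t : ℝ) {l : ℝ} (hl : 0 ≤ l) :
    (#(T.filter fun y => t ≤ Z y) : ℝ) * Real.exp (l * t) ≤ ∑ y ∈ T, Real.exp (l * Z y) := by
  calc (#(T.filter fun y => t ≤ Z y) : ℝ) * Real.exp (l * t)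
      = ∑ y ∈ T.filter (fun y => t ≤ Z y), Real.exp (l * t) := by
        rw [sum_const, nsmul_eq_mul]
    _ ≤ ∑ y ∈ T.filter (fun y => t ≤ Z y), Real.exp (l * Z y) := by
        refine sum_le_sum fun y hy => ?_
        exact Real.exp_le_exp.2 (mul_le_mul_of_nonneg_left (mem_filter.1 hy).2 hl)
    _ ≤ ∑ y ∈ T, Real.exp (l * Z y) :=
        sum_le_sum_of_subset_of_nonneg (filter_subset _ _) fun y _ _ => (Real.exp_pos _).le

/-- **One-sided Hoeffding bound for sums of functions of independent residues.** With the
hypotheses of `sum_exp_mul_sum_le` and `S ≠ ∅`, for `t > 0`: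
`#{y < P : t ≤ ∑_p g_p(y mod p)} ≤ P exp(-t²/(2 D² #S))`. [folklore] -/
theorem card_filter_le_sum_le (S : Finset ℕ) (hS : ∀ p ∈ S, p.Prime) (hSne : S.Nonempty)
    {g : ℕ → ℕ → ℝ} {D : ℝ} (hD : 0 < D) (hg : ∀ p ∈ S, ∀ r ∈ range p, |g p r| ≤ D)
    (h0 : ∀ p ∈ S, ∑ r ∈ range p, g p r = 0) {t : ℝ} (ht : 0 < t) :
    (#((range (∏ p ∈ S, p)).filter fun y => t ≤ ∑ p ∈ S, g p (y % p)) : ℝ) ≤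
      (∏ p ∈ S, p : ℕ) * Real.exp (-t ^ 2 / (2 * D ^ 2 * #S)) := by
  have hS0 : (0 : ℝ) < #S := by exact_mod_cast card_pos.2 hSne
  set l : ℝ := t / (D ^ 2 * #S) with hl
  have hl0 : 0 ≤ l := by positivity
  have h1 := card_filter_le_mul_exp_le (T := range (∏ p ∈ S, p))
    (fun y => ∑ p ∈ S, g p (y % p)) t hl0
  have h2 := sum_exp_mul_sum_le S hS hD hg h0 l
  have h3 := h1.trans h2
  rw [← le_div_iff₀ (Real.exp_pos _)] at h3
  refine h3.trans (le_of_eq ?_)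
  rw [mul_div_assoc, ← Real.exp_sub]
  congr 2
  rw [hl]
  field_simp
  ring

/-- **Hoeffding's inequality for sums of functions of independent residues** (the finite
probability-free form of Tao 2016, Lemma 3.5: "the `y mod p` are uniformly distributed in `ℤ/pℤ`
and are jointly independent in `p`"). Let `S ≠ ∅` be a finite set of primes, `P = ∏_{p∈S} p`,
and `f_p : ℕ → ℝ` with `|f_p| ≤ C` on `[0, p)` (`C > 0`). Put `Z(y) = ∑_{p∈S} f_p(y mod p)` and
`μ = ∑_{p∈S} p⁻¹ ∑_{r<p} f_p(r)` (its mean over `y ∈ ℤ/Pℤ`). Then for `t > 0`,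
`#{y < P : t ≤ |Z(y) - μ|} ≤ 2 P exp(-t²/(8 C² #S))`.
[cite: TaoFMP2016, §3 Lemma 3.5] -/
theorem card_filter_le_abs_sum_sub_le (S : Finset ℕ) (hS : ∀ p ∈ S, p.Prime) (hSne : S.Nonempty)
    (f : ℕ → ℕ → ℝ) {C : ℝ} (hC : 0 < C) (hf : ∀ p ∈ S, ∀ r ∈ range p, |f p r| ≤ C)
    {t : ℝ} (ht : 0 < t) :
    (#((range (∏ p ∈ S, p)).filter fun y =>
        t ≤ |∑ p ∈ S, f p (y % p) - ∑ p ∈ S, (1 / p : ℝ) * ∑ r ∈ range p, f p r|) : ℝ) ≤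
      2 * (∏ p ∈ S, p : ℕ) * Real.exp (-t ^ 2 / (8 * C ^ 2 * #S)) := by
  -- centred summands
  set g : ℕ → ℕ → ℝ := fun p r => f p r - (1 / p : ℝ) * ∑ r' ∈ range p, f p r' with hg
  have hmean : ∀ p ∈ S, |(1 / p : ℝ) * ∑ r' ∈ range p, f p r'| ≤ C := by
    intro p hp
    have hp0 : (0 : ℝ) < p := by exact_mod_cast (hS p hp).pos
    rw [abs_mul, abs_of_pos (by positivity : (0 : ℝ) < 1 / p)]
    calc 1 / (p : ℝ) * |∑ r' ∈ range p, f p r'| ≤ 1 / p * ∑ r' ∈ range p, |f p r'| :=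
          mul_le_mul_of_nonneg_left (abs_sum_le_sum_abs _ _) (by positivity)
      _ ≤ 1 / p * (p * C) := by
          refine mul_le_mul_of_nonneg_left ?_ (by positivity)
          calc ∑ r' ∈ range p, |f p r'| ≤ ∑ r' ∈ range p, C := sum_le_sum (hf p hp)
            _ = p * C := by rw [sum_const, card_range, nsmul_eq_mul]
      _ = C := by field_simp
  have hgD : ∀ p ∈ S, ∀ r ∈ range p, |g p r| ≤ 2 * C := by
    intro p hp r hr
    simp only [hg]
    calc |f p r - (1 / p : ℝ) * ∑ r' ∈ range p, f p r'|
        ≤ |f p r| + |(1 / p : ℝ) * ∑ r' ∈ range p, f p r'| := abs_sub _ _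
      _ ≤ C + C := add_le_add (hf p hp r hr) (hmean p hp)
      _ = 2 * C := by ring
  have hg0 : ∀ p ∈ S, ∑ r ∈ range p, g p r = 0 := by
    intro p hp
    have hp0 : (p : ℝ) ≠ 0 := by exact_mod_cast (hS p hp).ne_zero
    simp only [hg, sum_sub_distrib, sum_const, card_range, nsmul_eq_mul]
    field_simp
    ring
  have hgneg : ∀ p ∈ S, ∀ r ∈ range p, |(-g p r)| ≤ 2 * C := by
    intro p hp r hr; rw [abs_neg]; exact hgD p hp r hr
  have hg0neg : ∀ p ∈ S, ∑ r ∈ range p, (-g p r) = 0 := by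
    intro p hp; rw [sum_neg_distrib, hg0 p hp, neg_zero]
  have hZ : ∀ y, ∑ p ∈ S, f p (y % p) - ∑ p ∈ S, (1 / p : ℝ) * ∑ r ∈ range p, f p r
      = ∑ p ∈ S, g p (y % p) := by
    intro y; simp only [hg, sum_sub_distrib]
  have hD : (0 : ℝ) < 2 * C := by positivity
  have hup := card_filter_le_sum_le S hS hSne hD hgD hg0 ht
  have hdown := card_filter_le_sum_le S hS hSne (g := fun p r => -g p r) hD hgneg hg0neg ht
  -- split the two-sided event
  set T := range (∏ p ∈ S, p) with hT
  have hsplit : T.filter (fun y => t ≤ |∑ p ∈ S, f p (y % p)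
        - ∑ p ∈ S, (1 / p : ℝ) * ∑ r ∈ range p, f p r|)
      ⊆ T.filter (fun y => t ≤ ∑ p ∈ S, g p (y % p)) ∪
        T.filter (fun y => t ≤ ∑ p ∈ S, (-g p (y % p))) := by
    intro y hy
    rw [mem_filter, hZ y] at hy
    rw [mem_union, mem_filter, mem_filter, sum_neg_distrib]
    rcases le_abs'.1 hy.2 with h | h
    · exact Or.inr ⟨hy.1, by linarith⟩
    · exact Or.inl ⟨hy.1, h⟩
  have hexp : -t ^ 2 / (2 * (2 * C) ^ 2 * #S) = -t ^ 2 / (8 * C ^ 2 * #S) := by ring_nf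
  rw [hexp] at hup hdown
  calc (#(T.filter (fun y => t ≤ |∑ p ∈ S, f p (y % p)
          - ∑ p ∈ S, (1 / p : ℝ) * ∑ r ∈ range p, f p r|)) : ℝ)
      ≤ #(T.filter (fun y => t ≤ ∑ p ∈ S, g p (y % p)) ∪
          T.filter (fun y => t ≤ ∑ p ∈ S, (-g p (y % p)))) := by
        exact_mod_cast card_le_card hsplit
    _ ≤ #(T.filter (fun y => t ≤ ∑ p ∈ S, g p (y % p))) +
          #(T.filter (fun y => t ≤ ∑ p ∈ S, (-g p (y % p)))) := by
        exact_mod_cast card_union_le _ _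
    _ ≤ (∏ p ∈ S, p : ℕ) * Real.exp (-t ^ 2 / (8 * C ^ 2 * #S)) +
          (∏ p ∈ S, p : ℕ) * Real.exp (-t ^ 2 / (8 * C ^ 2 * #S)) := add_le_add hup hdown
    _ = 2 * (∏ p ∈ S, p : ℕ) * Real.exp (-t ^ 2 / (8 * C ^ 2 * #S)) := by ring

end Tao2016

end Literature.NumberTheory.LFunctions

end
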